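import Summits.QuantumFields.YangMills.Theorems.BalabanUVNodesN22AtRecordOfTermDataTableGermsLocatedRadiiContinuedSectors

/-!
# BalabanUVNodes ∕ node N22 = NE9 — THE ROAD-2 SOCKET OF RECORD (g20) AT def-W1's CONTINUED TERMS: module J85 §2 at `Tc K := (𝔇 K).continuedTF (χu K) (χcu K) (𝒲 K) (𝒪 K) θ.γ`
# with the agreement row `hagree` DISCHARGED by the bill's own unscaled-field law (`TermData214.continuedTF_ofReal_eq_TF`) — every last-coupling input of N22's ROAD-2 bill at
# def-W1's term data is now a per-term letter of def-W1's DESIGNATED holomorphic continuation in the last coupling (the window-dilated member read from base point `γ`)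

Cell `pub-ymgap`, HUMAN RULING D-0062 (Track A), R134 seat `pub-ymgap-dag-n22-c` (strategy s1: «the history-Lipschitz estimate (2.40)–(2.41) p. 21 of [II] on the W1 object»), generation
20, module J85c.  THEOREMS ONLY (no `def`, no `sorry`, standard axioms); `--kind proof --supports stmt-QuantumFields-27366 --as helper` (K3⁸ `SpineGivenEndpointR13SepCoPHV`), COUNT-NEUTRAL.
Imports this lane's module J85 `…N22AtRecordOfTermDataTableGermsLocatedRadiiContinuedSectors` only.  Nothing re-declared; consumed BY NAME.  ROAD-1 twin: module J81c.

WHY.  Module J85 keyed the last-coupling side of the ROAD-2 bill on the per-term sector letters of a DISPLAYED continued term family `Tc` with `hagree : Tc K k Z s ↑t old φ = (𝔇 K k).TF Z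
s ↑t old φ` (`t ∈ ]0, γ]`).  def-W1's `Node00/HistoryTermDatum214WindowDilated` §4–§5 DESIGNATES the continuation — `TermData214.continuedTF χu χcu 𝒲 𝒪 γ k Z s u old φ = memberTF … γ k
Z s (γ∕u) old φ`, the window-dilated member of base point `γ` ([I] p. 267 «B = g_kB′» at the fixed real coupling `γ`, then the complex DILATION parameter `b = γ∕u` on the interior
precision (`b²`), the cross kernel (`b`) and the Wilson part (`b²`); boxes and older terms `b`-free — NO threshold is continued, cf. module J80A) — and proves `continuedTF_ofReal_eq_TF`:
under the unscaled-field law it AGREES with the datum's display at every real window coupling.  The bill carries that law (`hlaw`), so at `Tc := continuedTF` the row `hagree` is a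
THEOREM of the bill: THIS FILE instantiates J85 §2 there.  The displayed last-coupling letters now read: (TS-holo) `z ↦ (𝔇 K).continuedTF (χu K) (χcu K) (𝒲 K) (𝒪 K) θ.γ k Z s z old
φ` complex differentiable on `O K ⊇ closedBall s (c_S·s)`; (TS-226) its (2.26) weight on `O K`; the z-free centre `T₀` with (TS-226₀); (TS-centred) `‖continuedTF … z … − T₀ …‖ ≤
C_q‖z‖²·weight·e^{a₅|Z|}` on `O K` — the member statements hMlast ∕ hMcen of this lane's g6–g7 relative-disc road (`…N22W1RelCentredSectorOfWindowDilated`,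
`…MembersOfDatum{Bound,Centred}`) and of node N10's `B13Term214WindowDilated` §4 ∕ `B13Term214Centred` ∕ `B13Bound226Centred`, from NODE A's located primitive inputs.
* §1 ★★★ socket `n22At_u3OfRecord₁₃_of_kernelStepRate_termDataTableGermsLocatedRadiiContinuedTFSectorsNonexpansive` — binder diff vs J85 §2: `Tc hagree` OUT; the letters `hTh hT226
  hTq` read `(𝔇 K).continuedTF (χu K) (χcu K) (𝒲 K) (𝒪 K) θ.γ k Z s z old φ`; vs J79 §2: ONLY that carrier change.  **THE ROAD-2 SOCKET OF RECORD (g20).**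
THE N22 ROAD-2 BILL AT def-W1's TERM DATA AFTER J85c: N18's kernel step rate `h5`; (1.21) `hlim`; W1-20's law `hloc`; NODE A's located (2.26) records `hι` (N10 per-slice, τ-radii
margin) and `hloc18` (N18 per-step); def-W1's laws (`UnscaledFieldLawOn`, `ReadsBy` + atom regularity, `MapsToTables … univ` on windows `W ⊇ sp`, `𝒲` measurable); the PER-TERM
complex-last-coupling letters OF THE CONTINUED TERMS on the sectors: `hTh`, `hT226`, centre `T₀` with `hT₀`, centred vertex `hTq` (UNPRINTED as estimates — this lane's census since
g6, desk ME #17 «nowhere — inspection-level»); chart DATA; numerics; standing rows — as in J79 otherwise.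

HONEST FRAMING (binding).  Count-neutral INSTANCE of module J85 §2 BY NAME (`hagree := continuedTF_ofReal_eq_TF (hlaw K)`); the letters of the continued terms, the located
records, the laws, the chart data, the numerics and every other binder are DISPLAYED HYPOTHESES; NO estimate of Bałaban's is proved or asserted; nothing of the record is constructed
or claimed to meet the displayed inputs.  N18, N10 and N22 are NOT discharged (typed 28∕28; count 7∕27 per dag-lead TABLE — N22 unchanged); K3⁸ OPEN and NOT claimed; NE9 ∕ NE5 NOT
IN PRINT for d = 4; no count claim; one finite 𝕋⁴ programme at fixed ε — R4 closes the CONDITIONAL rung `BalabanLadder.UV` only; NOTHING about the continuum limit, ℝ⁴, infinite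
volume, OS axioms, a mass gap or the Clay problem is proved or claimed.  References (TYPES only): [II] = Bałaban, CMP 116 (1988) (1.41) p. 11, (2.13)–(2.15) pp. 14–15, (2.26) p. 17,
Lemma 3 (2.38) p. 20, (2.39)–(2.41) p. 21; [I] = CMP 109 (1987) (1.17)–(1.18) p. 263, (2.9)–(2.13) pp. 266–268 («B = g_kB′» p. 267); Kotecký–Preiss, CMP 103 (1986) Thm p. 492;
King, CMP 102 (1986) Lemma 4.5 (4.38).
-/

noncomputable section

open Set Metric
open scoped BigOperators

namespace YMDAG.N22.KernelFading

open Literature.MathematicalPhysics.QuantumFieldTheory.Balaban1983to89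
open Literature.MathematicalPhysics.QuantumFieldTheory.Balaban1983to89.T4Continuum (T4Family ULoop)
open Literature.MathematicalPhysics.QuantumFieldTheory.Balaban1983to89.T4OutputRate (Window NE9)
open Literature.MathematicalPhysics.QuantumFieldTheory.Balaban1983to89.TreeLengthTorus (TPt TDom tsys torusTreeLen)
open Literature.MathematicalPhysics.QuantumFieldTheory.Balaban1983to89.B9Thm37GlueTorus (tdist1)
open Literature.MathematicalPhysics.QuantumFieldTheory.Balaban1983to89.B12TreeDecay (K₀ kappa₀)
open Literature.MathematicalPhysics.QuantumFieldTheory.Balaban1983to89.B12Decay510 (delta1)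
open Literature.MathematicalPhysics.QuantumFieldTheory.Balaban1983to89.B12Decay510Window (K₁)
open Literature.MathematicalPhysics.QuantumFieldTheory.Balaban1983to89.B12Decay510Torus (distCT nearT)
open Literature.MathematicalPhysics.QuantumFieldTheory.Balaban1983to89.B13Lemma3TorusData (TBond)
open Literature.MathematicalPhysics.QuantumFieldTheory.Balaban1983to89.B13Lemma3TorusTerms (terms weight)
open Literature.MathematicalPhysics.QuantumFieldTheory.Balaban1983to89.B13Lemma3TorusSocket (Lemma3Numerics)
open Literature.MathematicalPhysics.QuantumFieldTheory.Balaban1983to89.B13OlderTermsTableGerms (Pot cv ρ)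
open Literature.MathematicalPhysics.QuantumFieldTheory.Balaban1983to89.Node00 (Stage13Params Stage13HParams U3Letters₁₁ MatA)
open Literature.MathematicalPhysics.QuantumFieldTheory.Balaban1983to89.Node00.Sect2 (domSys domCount CPair)
open Literature.MathematicalPhysics.QuantumFieldTheory.Balaban1983to89.Node00.W1
open Literature.MathematicalPhysics.QuantumFieldTheory.Balaban1983to89.Node00.LocalizedSum17 (ReadingMaps Localizes17OfRecord₁₃)
open Literature.MathematicalPhysics.QuantumFieldTheory.Balaban1983to89.Node00.U3OfKernels (histPrefix objectsOfRecord₁₃)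
open Literature.MathematicalPhysics.QuantumFieldTheory.Balaban1983to89.Node00.U3KernelLetters (KernelStepRateOfRecord₁₃ PolLimitsExistOfRecord₁₃)
open YMDAG.UVSplit (N22At u3OfRecord₁₃ RateReading₁₃CoPH rateCarriersOfRecord₁₃CoPH)
open YMDAG.N22.AtKernels (n22At_u3OfRecord₁₃_objectsOfRecord₁₃_iff)
open YMDAG.N10 (lastCouplingSectors_ofTerms_of_termSectors)
open YMDAG.N22.TermRecursion (genT1last_of_lastSectorHolo genT2last_of_lastSectorHolo)

open scoped Matrix Matrix.Norms.L2Operator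

variable (F : T4Family) (N : ℕ) [NeZero N] {𝔸 : Type} [NormedRing 𝔸] [NormedAlgebra ℂ 𝔸]

/-! ## §1 ★★★ The kernel-face socket at def-W1's CONTINUED terms `TermData214.continuedTF` — `hagree` discharged by the bill's own unscaled-field law -/

open Classical Finset in
/-- ★★★ **THE ROAD-2 KERNEL-FACE SOCKET AT def-W1's CONTINUED TERMS (g20 socket of record on ROAD 2)** — module J85 §2 at `Tc K := (𝔇 K).continuedTF (χu K) (χcu K) (𝒲 K) (𝒪 K) θ.γ`,
`hagree := continuedTF_ofReal_eq_TF (hlaw K)` ⟹ **`N22At (u3OfRecord₁₃ θ (objectsOfRecord₁₃ F N θ ℓ) k)` for EVERY run length `k`** (dag-n27-c's `h22` row; plug = J79 §2's shape with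
the letters `hTh hT226 hTq` read on `continuedTF`).  LOCATED (hypothesis form); N22 NOT discharged. [folklore] -/
theorem n22At_u3OfRecord₁₃_of_kernelStepRate_termDataTableGermsLocatedRadiiContinuedTFSectorsNonexpansive (θ : Stage13Params F N) (ℓ : U3Letters₁₁) (hs : ℓ.Signs) (hγ : 0 < θ.γ)
    (hlim : PolLimitsExistOfRecord₁₃ F N θ) {κ₅ C₅ : ℝ} (hC₅ : 0 ≤ C₅) (h5 : KernelStepRateOfRecord₁₃ F N θ κ₅ ℓ.θ₅ C₅)
    (m' : ℕ) (M : ℕ) [NeZero M] (hM : M = F.L ^ m')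
    {c₀ : B13.Consts} {L : ℕ} [NeZero L] (𝔇 : (K : ℕ) → TermData214 c₀ (F.P K) 𝔸 M L) (emb : ReadingMaps F (MatA N) 𝔸)
    (hloc : Localizes17OfRecord₁₃ F N θ (fun K => truncRun K (toClusterTower (𝔇 K).Gn)) emb)
    (sp : (K j : ℕ) → (domSys (F.P K) M j).Dom → Set (CPair (F.P K) 𝔸))
    (hsp : ∀ (K j : ℕ) (Y : (domSys (F.P K) M j).Dom), IsOpen (sp K j Y))
    {κ κE δ₀ B₃ r R E₀ ϱ Mb cw cS Bq r₁ : ℝ} {aw : ℕ → ℕ → ℕ → ℝ}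
    (hκ₀ : kappa₀ (4 * 2 ^ 4) (2 * 4) ≤ κ / 2) (hδ₀ : 0 < δ₀) (hB₃ : 0 ≤ B₃) (hr : 0 < r) (hκE : κ ≤ κE) (hκE0 : 0 ≤ κE) (hE₀ : 0 ≤ E₀)
    (big : (K j : ℕ) → (domSys (F.P K) M j).Dom → Set (CPair (F.P K) 𝔸))
    (hbigo : ∀ (K k : ℕ) (Z : (domSys (F.P K) M (k + 1)).Dom), IsOpen (big K (k + 1) Z))
    (hrestr : ∀ (K k : ℕ), SpRestr (sp K (k + 1))) (hbig : ∀ (K k : ℕ) (Z : (domSys (F.P K) M (k + 1)).Dom), sp K (k + 1) Z ⊆ big K (k + 1) Z)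
    (c : B13.Consts) (hL : 8 ≤ c.L) (hLc : c.L = L) (hκ₁ : 1 ≤ c.κ₁) (hα₆ : c.α₆ ≠ 0) {a a₂ a₂' a₅ Aabs : ℝ} (hN : Lemma3Numerics c M ((c.L : ℝ) / 2) a a₂ a₂' a₅ Aabs)
    {D : ℕ → Set ℂ}
    (hloc18 : ∀ (K k : ℕ), ∀ s ∈ D K, ∀ old : OlderTerms (F.P K) 𝔸 M k,
      (∀ (j : Fin (k + 1)) (Y : (domSys (F.P K) M j).Dom), ∀ ψ ∈ sp K j Y, ‖old j Y ψ‖ ≤ E₀ * Real.exp (-(r₁ * (domSys (F.P K) M j).dj Y))) →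
      (∀ (j : Fin (k + 1)) (Y : (domSys (F.P K) M j).Dom), AnalyticOnNhd ℂ (old j Y) (sp K j Y)) →
      ∀ (Z : (domSys (F.P K) M (k + 1)).Dom), ∀ t ∈ terms L M Z, ∀ φ₁ ∈ big K (k + 1) Z, ∃ ι : (𝔇 K k).Inputs226Holo c Z t s old φ₁ a a₅,
        (∀ φ ∈ big K (k + 1) Z, ∀ i j, DifferentiableOn ℂ (fun σ => (𝔇 K k).A Z t φ σ i j) {σ | ∀ j, σ j ∈ ι.Uσ}) ∧
        (∀ φ ∈ big K (k + 1) Z, ∀ i j, DifferentiableOn ℂ (fun σ => ((𝔇 K k).𝒦 Z t).G2 σ ((𝔇 K k).uOf Z t φ) i j) {σ | ∀ j, σ j ∈ ι.Uσ}) ∧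
        (∀ σ : TPt (F.P K).d (domCount (F.P K) M (k + 1)) → ℂ, (∀ j, σ j ∈ ι.Uσ) → ∀ i j, DifferentiableOn ℂ (fun φ => (𝔇 K k).A Z t φ σ i j) (big K (k + 1) Z)) ∧
        (∀ σ : TPt (F.P K).d (domCount (F.P K) M (k + 1)) → ℂ, (∀ j, σ j ∈ ι.Uσ) →
          ∀ i j, DifferentiableOn ℂ (fun φ => ((𝔇 K k).𝒦 Z t).G2 σ ((𝔇 K k).uOf Z t φ) i j) (big K (k + 1) Z)) ∧
        (∀ Y B, DifferentiableOn ℂ (fun φ => (𝔇 K k).𝒱 Z t s old φ Y B) (big K (k + 1) Z)) ∧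
        (∀ φ ∈ big K (k + 1) Z, ∀ Y, Measurable ((𝔇 K k).𝒱 Z t s old φ Y)) ∧
        (∀ φ ∈ big K (k + 1) Z, ∀ σ : TPt (F.P K).d (domCount (F.P K) M (k + 1)) → ℂ, (∀ j, σ j ∈ ι.Uσ) → ((𝔇 K k).A Z t φ σ).IsSymm) ∧
        (∀ φ ∈ big K (k + 1) Z, ∀ σ : TPt (F.P K).d (domCount (F.P K) M (k + 1)) → ℂ, (∀ j, σ j ∈ ι.Uσ) → (((𝔇 K k).A Z t φ σ).map Complex.re).PosDef) ∧
        (∀ φ ∈ big K (k + 1) Z, ∀ τ : TDom (F.P K).d (L * domCount (F.P K) M (k + 1)) → ℂ, (∀ Y, τ Y ∈ ι.Uτ Y) →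
          ∀ B, ∑ Y ∈ t.1, ‖τ Y‖ * ‖(𝔇 K k).𝒱 Z t s old φ Y B‖ ≤ ι.a₂₀ / 2 * (B ⬝ᵥ B) + ι.w) ∧
        (∀ φ ∈ big K (k + 1) Z, ∀ σ : TPt (F.P K).d (domCount (F.P K) M (k + 1)) → ℂ, (∀ j, σ j ∈ ι.Uσ) → ∀ b j, ‖((𝔇 K k).𝒦 Z t).G2 σ ((𝔇 K k).uOf Z t φ) b j‖ ≤
            ι.KG * Real.exp (-(ι.kap * tdist1 (𝔇 K k).Nf (((𝔇 K k).𝒦 Z t).locΛ b) (((𝔇 K k).𝒦 Z t).locN j)))) ∧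
        (∀ φ ∈ big K (k + 1) Z, ∀ σ : TPt (F.P K).d (domCount (F.P K) M (k + 1)) → ℂ, (∀ j, σ j ∈ ι.Uσ) → ∀ b b', ‖((𝔇 K k).A Z t φ σ)⁻¹ b b'‖ ≤
            ι.KCs * Real.exp (-(ι.kap * tdist1 (𝔇 K k).Nf (((𝔇 K k).𝒦 Z t).locΛ b) (((𝔇 K k).𝒦 Z t).locΛ b')))) ∧
        (∀ φ ∈ big K (k + 1) Z, ∀ σ : TPt (F.P K).d (domCount (F.P K) M (k + 1)) → ℂ, (∀ j, σ j ∈ ι.Uσ) →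
          ∀ b j, ‖(((𝔇 K k).𝒦 Z t).G2 σ ((𝔇 K k).uOf Z t φ) - ((𝔇 K k).𝒦 Z t).Γ₀.map (algebraMap ℝ ℂ)) b j‖ ≤
            ι.θΓ * Real.exp (-(ι.kap * tdist1 (𝔇 K k).Nf (((𝔇 K k).𝒦 Z t).locΛ b) (((𝔇 K k).𝒦 Z t).locN j)))) ∧
        (∀ φ ∈ big K (k + 1) Z, ∀ σ : TPt (F.P K).d (domCount (F.P K) M (k + 1)) → ℂ, (∀ j, σ j ∈ ι.Uσ) →
          ∀ b b', ‖(((𝔇 K k).A Z t φ σ)⁻¹ - ((𝔇 K k).𝒦 Z t).C.map (algebraMap ℝ ℂ)) b b'‖ ≤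
            ι.θC * Real.exp (-(ι.kap * tdist1 (𝔇 K k).Nf (((𝔇 K k).𝒦 Z t).locΛ b) (((𝔇 K k).𝒦 Z t).locΛ b')))) ∧
        (∀ φ ∈ big K (k + 1) Z, ∀ σ : TPt (F.P K).d (domCount (F.P K) M (k + 1)) → ℂ, (∀ j, σ j ∈ ι.Uσ) →
          ∀ b b', ‖((𝔇 K k).A Z t φ σ - ((𝔇 K k).𝒦 Z t).C⁻¹.map (algebraMap ℝ ℂ)) b b'‖ ≤
            ι.θE * Real.exp (-(ι.kap * tdist1 (𝔇 K k).Nf (((𝔇 K k).𝒦 Z t).locΛ b) (((𝔇 K k).𝒦 Z t).locΛ b')))))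
    (hD : ∀ K, ∀ t ∈ Ioc (0 : ℝ) θ.γ, ((t : ℝ) : ℂ) ∈ D K)
    {S : ℕ → ℕ → Type} [∀ K k, MeasurableSpace (S K k)] [∀ K k, TopologicalSpace (S K k)] [∀ K k, OpensMeasurableSpace (S K k)]
    (χu χcu : (K k : ℕ) → (𝔇 K k).UnscaledChi) (𝒲 : (K k : ℕ) → (𝔇 K k).UnscaledWilson) (𝒪 : (K k : ℕ) → (𝔇 K k).UnscaledOlder)
    (Rd : (K k : ℕ) → (Z : (domSys (F.P K) M (k + 1)).Dom) → (t : TermLabel (F.P K) M k L) → (𝔇 K k).ReadingAtoms Z t (S K k))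
    (W : (K k : ℕ) → (domSys (F.P K) M (k + 1)).Dom → TermLabel (F.P K) M k L → Set (CPair (F.P K) 𝔸))
    (hlaw : ∀ K, (𝔇 K).UnscaledFieldLawOn (χu K) (χcu K) (𝒲 K) (𝒪 K) θ.γ) (hread : ∀ K k, (𝔇 K k).ReadsBy (𝒪 K k) (Rd K k))
    (hmaps : ∀ (K k : ℕ) (Z : (domSys (F.P K) M (k + 1)).Dom) (t : TermLabel (F.P K) M k L), (Rd K k Z t).MapsToTables (sp K) (W K k Z t) univ)
    (hW : ∀ (K k : ℕ) (X Z : (domSys (F.P K) M (k + 1)).Dom), Subtype.val Z ⊆ Subtype.val X → ∀ s ∈ terms L M Z, sp K (k + 1) X ⊆ W K k Z s)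
    (hcont : ∀ (K k : ℕ) (Z : (domSys (F.P K) M (k + 1)).Dom) (t : TermLabel (F.P K) M k L), (Rd K k Z t).CfgContinuous)
    (hjc : ∀ (K k : ℕ) (Z : (domSys (F.P K) M (k + 1)).Dom) (t : TermLabel (F.P K) M k L), (Rd K k Z t).CfgJointContinuous)
    {Ck mk : ℝ} (hK : ∀ (K k : ℕ) (Z : (domSys (F.P K) M (k + 1)).Dom) (t : TermLabel (F.P K) M k L), (Rd K k Z t).KernelBounded Ck)
    (hμ : ∀ (K k : ℕ) (Z : (domSys (F.P K) M (k + 1)).Dom) (t : TermLabel (F.P K) M k L), (Rd K k Z t).FiniteMass mk) (hCk : 0 ≤ Ck) (hmk : 0 ≤ mk)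
    (hWm : ∀ (K k : ℕ) (Z : (domSys (F.P K) M (k + 1)).Dom) (t : TermLabel (F.P K) M k L) (φ : CPair (F.P K) 𝔸) (Y : TDom (F.P K).d (L * domCount (F.P K) M (k + 1))),
      Measurable fun B : ((𝔇 K k).𝒦 Z t).Λ → ℝ => 𝒲 K k Z t φ Y B)
    {b : ℝ} (hb : 0 < b) (hbaw : ∀ K k j, b ≤ aw K k j)
    (hι : ∀ (K k : ℕ), ∀ t ∈ Ioc (0 : ℝ) θ.γ, ∀ (X : (domSys (F.P K) M (k + 1)).Dom), ∀ φ ∈ sp K (k + 1) X,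
      ∀ Z : (domSys (F.P K) M (k + 1)).Dom, Subtype.val Z ⊆ Subtype.val X → ∀ s ∈ terms L M Z,
        ∃ old₀ ∈ AdmHist (sp K) E₀ r₁ k, ∃ ι : (𝔇 K k).Inputs226Holo c Z s ((t : ℝ) : ℂ) old₀ φ a a₅, ∃ w₀ : ℝ,
          (∀ τ : TDom (F.P K).d (L * domCount (F.P K) M (k + 1)) → ℂ, (∀ Y, τ Y ∈ ι.Uτ Y) → ∀ B : ((𝔇 K k).𝒦 Z s).Λ → ℝ,
            ∑ Y ∈ s.1, ‖τ Y‖ * ‖(𝔇 K k).𝒱 Z s ((t : ℝ) : ℂ) old₀ φ Y B‖ ≤ ι.a₂₀ / 2 * (B ⬝ᵥ B) + w₀) ∧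
          w₀ + (∑ Y ∈ s.1, ((B13Bound143.invTau c ((tsys (F.P K).d (L * domCount (F.P K) M (k + 1))).dj Y))⁻¹ + (𝔇 K k).r + 2)) *
            ((∑ _j : Fin (k + 1), ∑ _X : (domSys (F.P K) M _j).Dom, Ck) * mk * (E₀ + b⁻¹ * R)) ≤ ι.w)
    (hA0 : 0 ≤ c.C3act * c.ε₁) (hr₁ : 0 ≤ r₁) (hrate : r₁ + 2 * (64 * Real.log 162) + 2 ≤ (1 - 8 * c.δ) * ((c.L : ℝ) / 2) * c.κ)
    (hKP : c.C3act * c.ε₁ * Real.exp (5 * r₁ + 1) * K₀ 64 8 * 9 * 64 < 1) (hκr : κE ≤ r₁) (hrenew : Real.exp 1 * 9 * 64 * K₀ 64 8 ^ 2 * (c.C3act * c.ε₁) ≤ Mb)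
    (hrenewE : Real.exp 1 * 9 * 64 * K₀ 64 8 ^ 2 * (c.C3act * c.ε₁) ≤ E₀)
    (hawcw : ∀ K k j, aw K k j ≤ cw) (hC1 : 4 * Mb * cw / ϱ < 1)
    (hMb0 : 0 ≤ Mb) (hϱ : 0 < ϱ) (hR : cw * E₀ + ϱ < R)
    (O : ℕ → Set ℂ) (hO : ∀ K, IsOpen (O K)) (hcS : 0 < cS) (hBq : 0 ≤ Bq)
    (hballS : ∀ K, ∀ s ∈ Ioc (0 : ℝ) θ.γ, closedBall (s : ℂ) (cS * s) ⊆ O K)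
    (hsmall2 : 2 * (c.C3act * c.ε₁) * Real.exp (5 * r₁ + 1) * K₀ 64 8 * 9 * 64 ≤ 1)
    (T₀ : (K k : ℕ) → (domSys (F.P K) M (k + 1)).Dom → TermLabel (F.P K) M k L → OlderTerms (F.P K) 𝔸 M k → CPair (F.P K) 𝔸 → ℂ) {Cq : ℝ} (hCq : 0 ≤ Cq)
    (hBqv : 2 * (Real.exp 1 * 9 * 64 * K₀ 64 8 ^ 2 * (2 * (c.C3act * c.ε₁))) * Cq * (1 + cS) ^ 2 ≤ Bq)
    (hTh : ∀ (K k : ℕ) (old : OlderTerms (F.P K) 𝔸 M k), old ∈ AdmHist (sp K) E₀ r₁ k ∧ old 0 = 0 → ∀ (X : (domSys (F.P K) M (k + 1)).Dom), ∀ φ ∈ sp K (k + 1) X,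
      ∀ Z : (domSys (F.P K) M (k + 1)).Dom, Subtype.val Z ⊆ Subtype.val X → ∀ s ∈ terms L M Z, DifferentiableOn ℂ (fun z => (𝔇 K).continuedTF (χu K) (χcu K) (𝒲 K) (𝒪 K) θ.γ k Z s z old φ) (O K))
    (hT226 : ∀ (K k : ℕ) (old : OlderTerms (F.P K) 𝔸 M k), old ∈ AdmHist (sp K) E₀ r₁ k ∧ old 0 = 0 → ∀ (X : (domSys (F.P K) M (k + 1)).Dom), ∀ φ ∈ sp K (k + 1) X,
      ∀ Z : (domSys (F.P K) M (k + 1)).Dom, Subtype.val Z ⊆ Subtype.val X → ∀ s ∈ terms L M Z, ∀ z ∈ O K,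
        ‖(𝔇 K).continuedTF (χu K) (χcu K) (𝒲 K) (𝒪 K) θ.γ k Z s z old φ‖ ≤ weight L M c Z a s * Real.exp (a₅ * ((Z.1).card : ℝ)))
    (hT₀ : ∀ (K k : ℕ) (old : OlderTerms (F.P K) 𝔸 M k), old ∈ AdmHist (sp K) E₀ r₁ k ∧ old 0 = 0 → ∀ (X : (domSys (F.P K) M (k + 1)).Dom), ∀ φ ∈ sp K (k + 1) X,
      ∀ Z : (domSys (F.P K) M (k + 1)).Dom, Subtype.val Z ⊆ Subtype.val X → ∀ s ∈ terms L M Z, ‖T₀ K k Z s old φ‖ ≤ weight L M c Z a s * Real.exp (a₅ * ((Z.1).card : ℝ)))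
    (hTq : ∀ (K k : ℕ) (old : OlderTerms (F.P K) 𝔸 M k), old ∈ AdmHist (sp K) E₀ r₁ k ∧ old 0 = 0 → ∀ (X : (domSys (F.P K) M (k + 1)).Dom), ∀ φ ∈ sp K (k + 1) X,
      ∀ Z : (domSys (F.P K) M (k + 1)).Dom, Subtype.val Z ⊆ Subtype.val X → ∀ s ∈ terms L M Z, ∀ z ∈ O K,
        ‖(𝔇 K).continuedTF (χu K) (χcu K) (𝒲 K) (𝒪 K) θ.γ k Z s z old φ - T₀ K k Z s old φ‖ ≤ Cq * ‖z‖ ^ 2 * (weight L M c Z a s * Real.exp (a₅ * ((Z.1).card : ℝ))))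
    (Ec : ℕ → ℕ → Type*) [∀ K k, NormedAddCommGroup (Ec K k)] [∀ K k, NormedSpace ℂ (Ec K k)]
    (ι : letI := θ.instVβ₁; letI := θ.instVβ₂
      (K k : ℕ) → (domSys (F.P K) M (k + 1)).Dom → ((Fin (F.P K).d → Site (F.P K) (k + 1) → θ.Vβ) →L[ℝ] Ec K k))
    (Φ : (K k : ℕ) → (domSys (F.P K) M (k + 1)).Dom → Ec K k → CPair (F.P K) 𝔸)
    (U : (K k : ℕ) → (domSys (F.P K) M (k + 1)).Dom → Set (Ec K k)) (hU : ∀ K k X, IsOpen (U K k X)) (hrU : ∀ K k X, ball (0 : Ec K k) r ⊆ U K k X)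
    (hΦhol : ∀ (K k : ℕ) (X : (domSys (F.P K) M (k + 1)).Dom), DifferentiableOn ℂ (Φ K k X) (U K k X))
    (hΦemb : letI := θ.instVβ₁; letI := θ.instVβ₂
      ∀ (K k : ℕ) (X : (domSys (F.P K) M (k + 1)).Dom) (Bf : Fin (F.P K).d → Site (F.P K) (k + 1) → θ.Vβ),
        Φ K k X (ι K k X Bf) = emb K k (fun l t => NormedSpace.exp (θ.ρ8 (Bf l t))))
    (hΦsp : ∀ (K k : ℕ) (X : (domSys (F.P K) M (k + 1)).Dom), ∀ z ∈ U K k X, ∀ Z : (domSys (F.P K) M (k + 1)).Dom, Z.1 ⊆ X.1 → Φ K k X z ∈ sp K (k + 1) Z)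
    (w : (K k : ℕ) → (domSys (F.P K) M (k + 1)).Dom → Site (F.P K) (k + 1) → ℝ) (hw₀ : ∀ K k X t, 0 ≤ w K k X t)
    (hw : letI := θ.instVβ₁; letI := θ.instVβ₂; letI := θ.instιβ
      ∀ (K k : ℕ) (X : (domSys (F.P K) M (k + 1)).Dom) (l : Fin (F.P K).d) (t : Site (F.P K) (k + 1)) (c : θ.ιβ),
        ‖ι K k X (Pi.single l (Pi.single t (θ.bV c)))‖ ≤ w K k X t)
    (htail : ∀ (K k : ℕ) (X : (domSys (F.P K) M (k + 1)).Dom) (t : Site (F.P K) (k + 1)),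
      let e : Site (F.P K) (k + 1) → TPt 4 (domCount (F.P K) M (k + 1) * M) := fun x i => (ZMod.cast (x i) : ZMod (domCount (F.P K) M (k + 1) * M))
      w K k X t ≤ B₃ * Real.exp (-δ₀ * distCT (domCount (F.P K) M (k + 1)) M (e t) (nearT (M := M) (e t) X)))
    (hκ₅ : delta1 δ₀ κ ((M : ℝ) * 4) ≤ κ₅)
    (hω : 0 < ℓ.ω) (hθω : ℓ.θ₅ ≤ ℓ.ω ^ 2) (hℓκ : ℓ.κ ≤ delta1 δ₀ κ ((M : ℝ) * 4))
    (hC₉ : (4 * (2 * C₅ / (1 - ℓ.θ₅) + 2 * ((16 * Mb * B₃ ^ 2 / r ^ 2) * Real.exp (delta1 δ₀ κ ((M : ℝ) * 4) * ((M : ℝ) * 4) * 3) * K₀ (4 * 2 ^ 4) (2 * 4) * K₁ 4 (δ₀ / 2))) / θ.γ +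
        ((16 * max ((6 * cS ^ 2 + 32 * cS + 64) / cS ^ 2 * Bq) (64 * Mb * cw ^ 2 / ϱ ^ 2 * (Bq * θ.γ / cS) ^ 2 / (1 - 4 * Mb * cw / ϱ)) * B₃ ^ 2 / r ^ 2) * Real.exp (delta1 δ₀ κ ((M : ℝ) * 4) * ((M : ℝ) * 4) * 3) * K₀ (4 * 2 ^ 4) (2 * 4) *
          K₁ 4 (δ₀ / 2)) * θ.γ / 2) / ℓ.ω ≤ ℓ.C₉) (k : ℕ) :
    N22At (u3OfRecord₁₃ θ (objectsOfRecord₁₃ F N θ ℓ) k) :=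
  n22At_u3OfRecord₁₃_of_kernelStepRate_termDataTableGermsLocatedRadiiContinuedSectorsNonexpansive F N
    θ ℓ hs hγ hlim hC₅ h5 m' M hM 𝔇 emb hloc sp hsp hκ₀ hδ₀ hB₃ hr hκE hκE0 hE₀ big hbigo hrestr hbig c hL hLc hκ₁ hα₆ hN hloc18 hD χu χcu 𝒲 𝒪 Rd W hlaw hread hmaps hW
    hcont hjc hK hμ hCk hmk hWm hb hbaw hι hA0 hr₁ hrate hKP hκr hrenew hrenewE hawcw hC1 hMb0 hϱ hR O hO hcS hBq hballS hsmall2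
    (fun K => (𝔇 K).continuedTF (χu K) (χcu K) (𝒲 K) (𝒪 K) θ.γ) (fun K k old _ _ φ _ Z _ s _ t ht => TermData214.continuedTF_ofReal_eq_TF (𝔇 K) (hlaw K) k Z s t ht old φ)
    T₀ hCq hBqv hTh hT226 hT₀ hTq Ec ι Φ U hU hrU hΦhol hΦemb hΦsp w hw₀ hw htail hκ₅ hω hθω hℓκ hC₉ k

end YMDAG.N22.KernelFading

end
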